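import Literature.MathematicalPhysics.QuantumLattice.WilsonHopFlatSections
import Literature.Analysis.InnerProduct.NearExtremalPhase
import Literature.Analysis.InnerProduct.UnitaryResolventBound
import Literature.Analysis.InnerProduct.KroneckerEigenvalues
import Mathlib.Analysis.SpecialFunctions.Trigonometric.Bounds
import Mathlib.Analysis.SpecialFunctions.Complex.Arg
import Mathlib.Algebra.Order.Round

/-!
# Line `corner-decorrelation-deep-hole`, stub S2a (flat mass on resonant plaquettes) — matrix toolkit

Auxiliary, model-independent lemmas for `stub_flatMassOnResonant`
(`Theorems/SpectralDefectExtinctionWindowExtinctionCornerFlatMassOnResonant.lean`):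

* Frobenius sums of squares `Σ_{i,j} |M i j|²` of rectangular complex matrices as squared Euclidean
  norms of the vectorisation `(j, i) ↦ M i j` in `EuclideanSpace ℂ (n × m)`; invariance under
  unitary two-sided multiplication; the reverse triangle (Kato) inequality for `√Σ|·|²`;
* the vectorised form of `Φ ↦ A Φ B` as the Kronecker matrix `Bᵀ ⊗ₖ A`, and COERCIVITY OFF
  RESONANCE: for unitary `M`, `R`, if no characteristic root `σ` of `M` is within `ε` of a conjugate
  characteristic root of `R`, then `ε² Σ|Φ|² ≤ Σ|Φ − M Φ R|²` (unitary resolvent bound + eigenvalues of a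
  Kronecker product);
* PLAQUETTE TELESCOPING: the holonomy defect of a section around a plaquette is bounded by the four
  link defects, `ε² Σ|Φ|² ≤ 4 (d₁² + d₂² + d₃² + d₄²)` off resonance;
* an enumeration of the characteristic roots of a `4 × 4` matrix by `Fin 4`, rounding of a unit phase to
  the grid `e^{ikε}`, unitarity of the chiral twist `(ū P⁻_μ + u P⁺_μ)ᵀ`, the plaquette identity
  `U_P · U(x,j) · U(x+ĵ,i) = U(x,i) · U(x+î,j)`, and the isometry/phase-alignment step for the Wilson
  hopping matrices.
-/

noncomputable section

namespace Summit.QuantumFields.QCD.Cruxes.WindowExtinction.CornerDecorrelationDeepHole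

open scoped BigOperators ComplexConjugate Kronecker Matrix InnerProductSpace
open Matrix Literature.MathematicalPhysics.QuantumLattice Literature.MathematicalPhysics.QuantumFieldTheory
  Literature.Probability.LatticeModels Literature.Analysis.InnerProduct

section Frobenius

variable {m n : Type*} [Fintype m] [Fintype n]

/-- The Frobenius sum of squares of a complex matrix is the squared Euclidean norm of its (transposed)
vectorisation `(j, i) ↦ M i j`. -/
theorem cornerFlat_norm_vec_sq (M : Matrix m n ℂ) :
    ‖(WithLp.toLp 2 (fun p : n × m => M p.2 p.1) : EuclideanSpace ℂ (n × m))‖ ^ 2 =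
      ∑ i, ∑ j, ‖M i j‖ ^ 2 := by
  rw [EuclideanSpace.norm_sq_eq, Fintype.sum_prod_type, Finset.sum_comm]

/-- The Euclidean norm of the vectorisation is `√(Σ_{i,j} |M i j|²)`. -/
theorem cornerFlat_norm_vec (M : Matrix m n ℂ) :
    ‖(WithLp.toLp 2 (fun p : n × m => M p.2 p.1) : EuclideanSpace ℂ (n × m))‖ =
      Real.sqrt (∑ i, ∑ j, ‖M i j‖ ^ 2) := by
  rw [← cornerFlat_norm_vec_sq, Real.sqrt_sq (norm_nonneg _)]

/-- Two-sided multiplication by an isometry on the left (`Aᴴ A = 1`) and a co-isometry on the right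
(`B Bᴴ = 1`) preserves the Frobenius sum of squares. -/
theorem cornerFlat_sum_norm_sq_unitary_mul [DecidableEq m] [DecidableEq n] {A : Matrix m m ℂ}
    (hA : Aᴴ * A = 1) {B : Matrix n n ℂ} (hB : B * Bᴴ = 1) (M : Matrix m n ℂ) :
    ∑ i, ∑ j, ‖(A * M * B) i j‖ ^ 2 = ∑ i, ∑ j, ‖M i j‖ ^ 2 := by
  rw [sum_norm_sq_eq_re_trace_conjTranspose_mul, sum_norm_sq_eq_re_trace_conjTranspose_mul,
    Matrix.mul_assoc, trace_conjTranspose_mul_isometry_mul A hA, conjTranspose_mul, Matrix.mul_assoc,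
    trace_mul_comm, Matrix.mul_assoc, Matrix.mul_assoc, hB, Matrix.mul_one]

/-- **Kato / reverse triangle inequality for the Frobenius norm**:
`(√Σ|P|² − √Σ|Q|²)² ≤ Σ|P − Q|²`. -/
theorem cornerFlat_sqrt_sub_sqrt_sq_le (P Q : Matrix m n ℂ) :
    (Real.sqrt (∑ i, ∑ j, ‖P i j‖ ^ 2) - Real.sqrt (∑ i, ∑ j, ‖Q i j‖ ^ 2)) ^ 2 ≤
      ∑ i, ∑ j, ‖(P - Q) i j‖ ^ 2 := by
  have hs : (WithLp.toLp 2 (fun p : n × m => (P - Q) p.2 p.1) : EuclideanSpace ℂ (n × m)) =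
      WithLp.toLp 2 (fun p : n × m => P p.2 p.1) - WithLp.toLp 2 (fun p : n × m => Q p.2 p.1) := rfl
  rw [← cornerFlat_norm_vec P, ← cornerFlat_norm_vec Q, ← cornerFlat_norm_vec_sq (P - Q), hs, ← sq_abs]
  exact pow_le_pow_left₀ (abs_nonneg _) (abs_norm_sub_norm_le _ _) 2

/-- The Frobenius norm `√Σ|·|²` is subadditive. -/
theorem cornerFlat_sqrt_add_le (P Q : Matrix m n ℂ) :
    Real.sqrt (∑ i, ∑ j, ‖(P + Q) i j‖ ^ 2) ≤
      Real.sqrt (∑ i, ∑ j, ‖P i j‖ ^ 2) + Real.sqrt (∑ i, ∑ j, ‖Q i j‖ ^ 2) := by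
  have hs : (WithLp.toLp 2 (fun p : n × m => (P + Q) p.2 p.1) : EuclideanSpace ℂ (n × m)) =
      WithLp.toLp 2 (fun p : n × m => P p.2 p.1) + WithLp.toLp 2 (fun p : n × m => Q p.2 p.1) := rfl
  rw [← cornerFlat_norm_vec P, ← cornerFlat_norm_vec Q, ← cornerFlat_norm_vec (P + Q), hs]
  exact norm_add_le _ _

/-- **Vectorised form of `Φ ↦ A Φ B`**: on the vectorisation `(j, i) ↦ Φ i j` the map acts as the
Kronecker matrix `Bᵀ ⊗ₖ A`. -/
theorem cornerFlat_kronecker_mulVec_vec (A : Matrix m m ℂ) (B : Matrix n n ℂ) (Φ : Matrix m n ℂ) :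
    (Bᵀ ⊗ₖ A) *ᵥ (fun p : n × m => Φ p.2 p.1) = fun p : n × m => (A * Φ * B) p.2 p.1 := by
  funext p
  simp only [Matrix.mulVec, dotProduct, Fintype.sum_prod_type, Matrix.kroneckerMap_apply,
    Matrix.transpose_apply, Matrix.mul_apply, Finset.sum_mul]
  exact Finset.sum_congr rfl fun b _ => Finset.sum_congr rfl fun j _ => by ring

end Frobenius

section Coercive

variable {m n : Type*} [Fintype m] [Fintype n] [DecidableEq m] [DecidableEq n]

/-- **Coercivity off resonance.**  For unitary `M` (on `m`) and `R` (on `n`, non-empty index types)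
and `0 ≤ ε`: if every characteristic root `σ` of `M` and every characteristic root `r` of `R` satisfy
`ε < |σ − conj r|`, then `ε² Σ|Φ|² ≤ Σ|Φ − M Φ R|²` for every `m × n` matrix `Φ` — the unitary
`Φ ↦ M Φ R` (`≅ Rᵀ ⊗ₖ M`) has all its eigenvalues `r σ` at distance `> ε` from `1`. -/
theorem cornerFlat_coercive [Nonempty m] [Nonempty n] {M : Matrix m m ℂ}
    (hM : M ∈ Matrix.unitaryGroup m ℂ) {R : Matrix n n ℂ} (hR : R ∈ Matrix.unitaryGroup n ℂ)
    (Φ : Matrix m n ℂ) {ε : ℝ} (hε : 0 ≤ ε)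
    (hres : ∀ σ ∈ M.charpoly.roots, ∀ r ∈ R.charpoly.roots, ε < ‖σ - conj r‖) :
    ε ^ 2 * (∑ i, ∑ j, ‖Φ i j‖ ^ 2) ≤ ∑ i, ∑ j, ‖(Φ - M * Φ * R) i j‖ ^ 2 := by
  have hRt : Rᵀ ∈ Matrix.unitaryGroup n ℂ := Matrix.transpose_mem_unitaryGroup_iff.mpr hR
  have hK : Rᵀ ⊗ₖ M ∈ Matrix.unitaryGroup (n × m) ℂ := Matrix.kronecker_mem_unitary hRt hM
  set x : EuclideanSpace ℂ (n × m) := WithLp.toLp 2 (fun p : n × m => Φ p.2 p.1) with hx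
  obtain ⟨z, hz, hle⟩ := unitary_exists_root_charpoly_norm_mul_le hK x
  obtain ⟨α, hα, β, hβ, -, -, hnorm⟩ :=
    exists_roots_norm_sub_conj_eq_of_mem_roots_charpoly_kronecker hRt M hz
  rw [Matrix.charpoly_transpose] at hα
  have hεz : ε ≤ ‖(1 : ℂ) - z‖ := by
    rw [norm_sub_rev, ← hnorm]
    exact (hres β hβ α hα).le
  have hKx : x - toEuclideanLin (Rᵀ ⊗ₖ M) x =
      WithLp.toLp 2 (fun p : n × m => (Φ - M * Φ * R) p.2 p.1) := by
    rw [Matrix.toLpLin_apply, hx, WithLp.ofLp_toLp, cornerFlat_kronecker_mulVec_vec, ← WithLp.toLp_sub]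
    rfl
  rw [← cornerFlat_norm_vec_sq, ← cornerFlat_norm_vec_sq, ← hKx, ← hx]
  calc ε ^ 2 * ‖x‖ ^ 2 = (ε * ‖x‖) ^ 2 := by ring
    _ ≤ (‖(1 : ℂ) - z‖ * ‖x‖) ^ 2 := by
        gcongr
    _ ≤ ‖x - toEuclideanLin (Rᵀ ⊗ₖ M) x‖ ^ 2 := pow_le_pow_left₀ (by positivity) hle 2

end Coercive

section Telescope

variable {m n : Type*} [Fintype m] [Fintype n]

/-- **Plaquette telescoping (algebra).**  The two-path transport difference around a plaquette is a
signed, transported sum of the four link defects. -/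
theorem cornerFlat_telescope_eq (G1 G2 G3 G4 : Matrix m m ℂ) (T0 T1 : Matrix n n ℂ)
    (Ψ0 Ψa Ψb Φ : Matrix m n ℂ) :
    G1 * G2 * Φ * T1 * T0 - G3 * G4 * Φ * T0 * T1 =
      -(Ψ0 - G1 * Ψa * T0) - G1 * (Ψa - G2 * Φ * T1) * T0 + (Ψ0 - G3 * Ψb * T1) +
        G3 * (Ψb - G4 * Φ * T0) * T1 := by
  simp only [Matrix.mul_sub, Matrix.sub_mul, Matrix.mul_assoc]
  abel

/-- **Plaquette telescoping (holonomy form).**  With `M G3 G4 = G1 G2` (the plaquette matrix `M`) and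
`T0 T1` a co-isometry, the two-path difference is the holonomy defect `M Φ' R − Φ'` of the transported
section `Φ' = G3 G4 Φ T0 T1`, `R = (T0 T1)ᴴ (T1 T0)`. -/
theorem cornerFlat_telescope_holonomy [DecidableEq n] {M G1 G2 G3 G4 : Matrix m m ℂ}
    {T0 T1 : Matrix n n ℂ} (hM : M * G3 * G4 = G1 * G2) (hT : T0 * T1 * (T0 * T1)ᴴ = 1)
    (Φ : Matrix m n ℂ) :
    G1 * G2 * Φ * T1 * T0 - G3 * G4 * Φ * T0 * T1 =
      M * (G3 * G4 * Φ * (T0 * T1)) * ((T0 * T1)ᴴ * (T1 * T0)) - G3 * G4 * Φ * (T0 * T1) := by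
  rw [← hM]
  have h : M * (G3 * G4 * Φ * (T0 * T1)) * ((T0 * T1)ᴴ * (T1 * T0)) =
      M * G3 * G4 * Φ * (T0 * T1 * (T0 * T1)ᴴ) * (T1 * T0) := by
    simp only [Matrix.mul_assoc]
  rw [h, hT, Matrix.mul_one]
  simp only [Matrix.mul_assoc]

/-- **Four-term triangle inequality for the telescoped defect** (Frobenius norm, unitary transports
dropped): `‖−(−Da − G1 Db T0 + Dc + G3 Dd T1)‖ ≤ ‖Da‖ + ‖Db‖ + ‖Dc‖ + ‖Dd‖`. -/
theorem cornerFlat_norm_telescope_le [DecidableEq m] [DecidableEq n] {G1 G3 : Matrix m m ℂ}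
    (hG1 : G1ᴴ * G1 = 1) (hG3 : G3ᴴ * G3 = 1) {T0 T1 : Matrix n n ℂ} (hT0 : T0 * T0ᴴ = 1)
    (hT1 : T1 * T1ᴴ = 1) (Da Db Dc Dd : Matrix m n ℂ) :
    Real.sqrt (∑ i, ∑ j, ‖(-(-Da - G1 * Db * T0 + Dc + G3 * Dd * T1)) i j‖ ^ 2) ≤
      Real.sqrt (∑ i, ∑ j, ‖Da i j‖ ^ 2) + Real.sqrt (∑ i, ∑ j, ‖Db i j‖ ^ 2) +
        Real.sqrt (∑ i, ∑ j, ‖Dc i j‖ ^ 2) + Real.sqrt (∑ i, ∑ j, ‖Dd i j‖ ^ 2) := by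
  set v : Matrix m n ℂ → EuclideanSpace ℂ (n × m) := fun X => WithLp.toLp 2 (fun p : n × m => X p.2 p.1)
    with hv
  have hvn : ∀ X, Real.sqrt (∑ i, ∑ j, ‖X i j‖ ^ 2) = ‖v X‖ := fun X => (cornerFlat_norm_vec X).symm
  have h1 : ‖v (G1 * Db * T0)‖ = ‖v Db‖ := by
    rw [← hvn, ← hvn, cornerFlat_sum_norm_sq_unitary_mul hG1 hT0]
  have h3 : ‖v (G3 * Dd * T1)‖ = ‖v Dd‖ := by
    rw [← hvn, ← hvn, cornerFlat_sum_norm_sq_unitary_mul hG3 hT1]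
  have e : v (-Da - G1 * Db * T0 + Dc + G3 * Dd * T1) =
      -v Da - v (G1 * Db * T0) + v Dc + v (G3 * Dd * T1) := rfl
  simp only [Matrix.neg_apply, norm_neg]
  rw [hvn, hvn, hvn, hvn, hvn, ← norm_neg, ← h1, ← h3, e]
  calc ‖-(-v Da - v (G1 * Db * T0) + v Dc + v (G3 * Dd * T1))‖
        ≤ ‖-v Da - v (G1 * Db * T0) + v Dc‖ + ‖v (G3 * Dd * T1)‖ := by
          rw [norm_neg]; exact norm_add_le _ _
    _ ≤ ‖-v Da - v (G1 * Db * T0)‖ + ‖v Dc‖ + ‖v (G3 * Dd * T1)‖ := by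
          gcongr; exact norm_add_le _ _
    _ ≤ ‖-v Da‖ + ‖v (G1 * Db * T0)‖ + ‖v Dc‖ + ‖v (G3 * Dd * T1)‖ := by
          gcongr; exact norm_sub_le _ _
    _ = ‖v Da‖ + ‖v (G1 * Db * T0)‖ + ‖v Dc‖ + ‖v (G3 * Dd * T1)‖ := by rw [norm_neg]

/-- **Site bound: a non-resonant plaquette repels flat mass.**  Let `G1, G3, G4` (colour) and `T0, T1`
(spin) be unitary, `M` unitary with `M G3 G4 = G1 G2` (so `M` is the plaquette matrix
`G1 G2 G4⁻¹ G3⁻¹`), `R = (T0 T1)ᴴ (T1 T0)`, and `0 ≤ ε`.  If no characteristic root of `M` is within `ε`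
of a conjugate characteristic root of `R`, then the mass `Σ|Φ|²` at the far corner is at most
`4/ε²` times the sum of the four squared link defects around the plaquette. -/
theorem cornerFlat_site_bound [DecidableEq m] [DecidableEq n] [Nonempty m] [Nonempty n]
    {M G1 G2 G3 G4 : Matrix m m ℂ}
    (hM : M ∈ Matrix.unitaryGroup m ℂ) (hG1 : G1 ∈ Matrix.unitaryGroup m ℂ)
    (hG3 : G3 ∈ Matrix.unitaryGroup m ℂ) (hG4 : G4 ∈ Matrix.unitaryGroup m ℂ)
    {T0 T1 : Matrix n n ℂ} (hT0 : T0 ∈ Matrix.unitaryGroup n ℂ) (hT1 : T1 ∈ Matrix.unitaryGroup n ℂ)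
    (hplaq : M * G3 * G4 = G1 * G2) (Ψ0 Ψa Ψb Φ : Matrix m n ℂ) {ε : ℝ} (hε : 0 ≤ ε)
    (hres : ∀ σ ∈ M.charpoly.roots, ∀ r ∈ ((T0 * T1)ᴴ * (T1 * T0)).charpoly.roots,
      ε < ‖σ - conj r‖) :
    ε ^ 2 * (∑ i, ∑ j, ‖Φ i j‖ ^ 2) ≤
      4 * ((∑ i, ∑ j, ‖(Ψ0 - G1 * Ψa * T0) i j‖ ^ 2) + (∑ i, ∑ j, ‖(Ψa - G2 * Φ * T1) i j‖ ^ 2) +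
        (∑ i, ∑ j, ‖(Ψ0 - G3 * Ψb * T1) i j‖ ^ 2) + ∑ i, ∑ j, ‖(Ψb - G4 * Φ * T0) i j‖ ^ 2) := by
  -- unitarity bookkeeping
  have hG34 : G3 * G4 ∈ Matrix.unitaryGroup m ℂ := mul_mem hG3 hG4
  have hT01 : T0 * T1 ∈ Matrix.unitaryGroup n ℂ := mul_mem hT0 hT1
  have hR : (T0 * T1)ᴴ * (T1 * T0) ∈ Matrix.unitaryGroup n ℂ :=
    mul_mem (Unitary.star_mem hT01) (mul_mem hT1 hT0)
  have hT : T0 * T1 * (T0 * T1)ᴴ = 1 := Matrix.mem_unitaryGroup_iff.mp hT01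
  set Φ' : Matrix m n ℂ := G3 * G4 * Φ * (T0 * T1) with hΦ'
  set Da := Ψ0 - G1 * Ψa * T0 with hDa
  set Db := Ψa - G2 * Φ * T1 with hDb
  set Dc := Ψ0 - G3 * Ψb * T1 with hDc
  set Dd := Ψb - G4 * Φ * T0 with hDd
  -- the transported section has the same mass
  have hmass : ∑ i, ∑ j, ‖Φ' i j‖ ^ 2 = ∑ i, ∑ j, ‖Φ i j‖ ^ 2 :=
    cornerFlat_sum_norm_sq_unitary_mul (Matrix.mem_unitaryGroup_iff'.mp hG34) hT Φ
  -- coercivity for the transported section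
  have hco := cornerFlat_coercive hM hR Φ' hε hres
  rw [hmass] at hco
  refine hco.trans ?_
  -- the holonomy defect is the telescoped sum of link defects
  have hdef : Φ' - M * Φ' * ((T0 * T1)ᴴ * (T1 * T0)) = -(-Da - G1 * Db * T0 + Dc + G3 * Dd * T1) := by
    rw [hDa, hDb, hDc, hDd, ← cornerFlat_telescope_eq, cornerFlat_telescope_holonomy hplaq hT Φ, ← hΦ',
      neg_sub]
  have h4 := cornerFlat_norm_telescope_le (Matrix.mem_unitaryGroup_iff'.mp hG1)
    (Matrix.mem_unitaryGroup_iff'.mp hG3) (Matrix.mem_unitaryGroup_iff.mp hT0)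
    (Matrix.mem_unitaryGroup_iff.mp hT1) Da Db Dc Dd
  have hnn : ∀ X : Matrix m n ℂ, 0 ≤ ∑ i, ∑ j, ‖X i j‖ ^ 2 := fun X =>
    Finset.sum_nonneg fun i _ => Finset.sum_nonneg fun j _ => by positivity
  rw [hdef]
  calc ∑ i, ∑ j, ‖(-(-Da - G1 * Db * T0 + Dc + G3 * Dd * T1)) i j‖ ^ 2
        = (Real.sqrt (∑ i, ∑ j, ‖(-(-Da - G1 * Db * T0 + Dc + G3 * Dd * T1)) i j‖ ^ 2)) ^ 2 :=
          (Real.sq_sqrt (hnn _)).symm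
    _ ≤ (Real.sqrt (∑ i, ∑ j, ‖Da i j‖ ^ 2) + Real.sqrt (∑ i, ∑ j, ‖Db i j‖ ^ 2) +
          Real.sqrt (∑ i, ∑ j, ‖Dc i j‖ ^ 2) + Real.sqrt (∑ i, ∑ j, ‖Dd i j‖ ^ 2)) ^ 2 :=
          pow_le_pow_left₀ (Real.sqrt_nonneg _) h4 2
    _ ≤ 4 * ((Real.sqrt (∑ i, ∑ j, ‖Da i j‖ ^ 2)) ^ 2 + (Real.sqrt (∑ i, ∑ j, ‖Db i j‖ ^ 2)) ^ 2 +
          (Real.sqrt (∑ i, ∑ j, ‖Dc i j‖ ^ 2)) ^ 2 + (Real.sqrt (∑ i, ∑ j, ‖Dd i j‖ ^ 2)) ^ 2) := by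
          -- `(a + b + c + d)² ≤ 4 (a² + b² + c² + d²)`
          set a := Real.sqrt (∑ i, ∑ j, ‖Da i j‖ ^ 2)
          set b := Real.sqrt (∑ i, ∑ j, ‖Db i j‖ ^ 2)
          set c := Real.sqrt (∑ i, ∑ j, ‖Dc i j‖ ^ 2)
          set d := Real.sqrt (∑ i, ∑ j, ‖Dd i j‖ ^ 2)
          nlinarith [sq_nonneg (a - b), sq_nonneg (a - c), sq_nonneg (a - d), sq_nonneg (b - c),
            sq_nonneg (b - d), sq_nonneg (c - d)]
    _ = _ := by rw [Real.sq_sqrt (hnn _), Real.sq_sqrt (hnn _), Real.sq_sqrt (hnn _), Real.sq_sqrt (hnn _)]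

end Telescope

section Grid

/-- The characteristic roots of an `N × N` complex matrix, enumerated (with repetitions) by `Fin N`:
every `r i` is a root and every root is some `r i`. -/
theorem cornerFlat_exists_roots_enum {N : ℕ} (R : Matrix (Fin N) (Fin N) ℂ) :
    ∃ r : Fin N → ℂ, (∀ i, r i ∈ R.charpoly.roots) ∧ ∀ β ∈ R.charpoly.roots, ∃ i, r i = β := by
  have hsplit : R.charpoly.Splits := IsAlgClosed.splits _
  have hlen : R.charpoly.roots.toList.length = N := by
    rw [Multiset.length_toList, ← hsplit.natDegree_eq_card_roots, Matrix.charpoly_natDegree_eq_dim,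
      Fintype.card_fin]
  refine ⟨fun i => R.charpoly.roots.toList.get (Fin.cast hlen.symm i), fun i => ?_, fun β hβ => ?_⟩
  · exact Multiset.mem_toList.mp (List.get_mem _ _)
  · obtain ⟨j, hj⟩ := List.get_of_mem (Multiset.mem_toList.mpr hβ)
    exact ⟨Fin.cast hlen j, hj⟩

/-- **Grid rounding of a unit phase.**  For `|c| = 1` and `ε > 0`, the integer `k = round(arg c / ε)`
has `|k| ≤ π/ε + 1` and `|c − e^{ikε}| ≤ ε/2`. -/
theorem cornerFlat_round_phase {c : ℂ} (hc : ‖c‖ = 1) {ε : ℝ} (hε : 0 < ε) :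
    |((round (Complex.arg c / ε) : ℤ) : ℝ)| ≤ Real.pi / ε + 1 ∧
      ‖c - Complex.exp (↑((round (Complex.arg c / ε) : ℝ) * ε) * Complex.I)‖ ≤ ε / 2 := by
  set φ : ℝ := Complex.arg c with hφ
  set t : ℝ := φ / ε with ht
  set k : ℤ := round t with hk
  have hround : |t - k| ≤ 1 / 2 := abs_sub_round t
  constructor
  · have h1 : |(k : ℝ)| - |t| ≤ |t - k| := by
      rw [abs_sub_comm t]
      exact abs_sub_abs_le_abs_sub _ _
    have h2 : |t| ≤ Real.pi / ε := by
      rw [ht, abs_div, abs_of_pos hε]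
      exact div_le_div_of_nonneg_right (Complex.abs_arg_le_pi c) hε.le
    have h3 : (1 : ℝ) / 2 ≤ 1 := by norm_num
    linarith
  · have hc' : Complex.exp (↑φ * Complex.I) = c := by
      have h := Complex.norm_mul_exp_arg_mul_I c
      rwa [hc, Complex.ofReal_one, one_mul] at h
    have key : c - Complex.exp (↑((k : ℝ) * ε) * Complex.I) =
        Complex.exp (↑((k : ℝ) * ε) * Complex.I) * (Complex.exp (Complex.I * ↑(φ - k * ε)) - 1) := by
      rw [mul_sub, mul_one, ← Complex.exp_add, ← hc',
        show (↑((k : ℝ) * ε) * Complex.I + Complex.I * ↑(φ - k * ε) : ℂ) = ↑φ * Complex.I by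
          push_cast; ring]
    rw [key, norm_mul, Complex.norm_exp_ofReal_mul_I, one_mul]
    calc ‖Complex.exp (Complex.I * ↑(φ - k * ε)) - 1‖ ≤ ‖φ - k * ε‖ :=
          Real.norm_exp_I_mul_ofReal_sub_one_le
      _ = ε * |t - k| := by
          rw [Real.norm_eq_abs, ht, ← abs_of_pos hε, ← abs_mul, abs_of_pos hε, mul_sub,
            mul_div_cancel₀ _ hε.ne']
          ring_nf
      _ ≤ ε * (1 / 2) := by gcongr
      _ = ε / 2 := by ring

end Grid

section Lattice

/-- **The chiral twist is unitary**: for a unit `u ∈ ℂ`, `(ū P⁻_μ + u P⁺_μ)ᵀ ∈ U(4)`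
(`P∓_μ` complementary orthogonal Hermitian projections). -/
theorem cornerFlat_twist_mem_unitaryGroup {u : ℂ} (hu : ‖u‖ = 1) (μ : Fin 4) :
    (conj u • chiralProjMinus μ + u • chiralProjPlus μ)ᵀ ∈ Matrix.unitaryGroup (Fin 4) ℂ := by
  rw [Matrix.transpose_mem_unitaryGroup_iff, Matrix.mem_unitaryGroup_iff, Matrix.star_eq_conjTranspose]
  have huu : conj u * u = 1 := by
    rw [Complex.conj_mul', hu]
    simp
  have huu' : u * conj u = 1 := by rw [mul_comm, huu]
  rw [conjTranspose_add, conjTranspose_smul, conjTranspose_smul, chiralProjMinus_conjTranspose,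
    chiralProjPlus_conjTranspose, Complex.star_def, Complex.conj_conj]
  simp only [add_mul, mul_add, Matrix.smul_mul, Matrix.mul_smul, smul_smul, chiralProjMinus_mul_self,
    chiralProjPlus_mul_self, chiralProjMinus_mul_chiralProjPlus, chiralProjPlus_mul_chiralProjMinus,
    smul_zero, add_zero, zero_add, huu, huu', one_smul, chiralProjMinus_add_chiralProjPlus]

/-- **Plaquette identity**: `U_P(x; i, j) · U(x, j) · U(x + ĵ, i) = U(x, i) · U(x + î, j)`. -/
theorem cornerFlat_plaquette_mul {G : Type*} [Group G] {d L : ℕ} (U : GaugeConfig d L G)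
    (x : Site d L) (i j : Fin d) :
    plaquetteHolonomy U x i j * U (x, j) * U (x.shift j, i) = U (x, i) * U (x.shift i, j) := by
  simp only [plaquetteHolonomy, mul_assoc, inv_mul_cancel, mul_one]

/-- **Phase alignment for the Wilson hopping matrices.**  For a unitary representation `ρ`, if
`4(1−θ) Σ|ψ|² ≤ |Σ_p conj(ψ p) (K_U ψ)(p)|` with `K_U = Σ_μ W_μ`, then some unit `u ∈ ℂ` has
`Σ_p |(W_μ ψ)(p) − u ψ(p)|² ≤ 8θ Σ|ψ|²` for every direction `μ` (the `W_μ` are isometries; apply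
`norm_sub_phase_smul_sq_le_of_sum_inner` in `EuclideanSpace`). -/
theorem cornerFlat_phase {L N : ℕ} [NeZero L] {G : Type*} [Group G]
    (ρ : G →* Matrix (Fin N) (Fin N) ℂ) (hρ : ∀ g, ρ g ∈ Matrix.unitaryGroup (Fin N) ℂ)
    (U : GaugeConfig 4 L G) (θ : ℝ) (ψ : TorusSite 4 L × Fin N × Fin 4 → ℂ)
    (hflat : 4 * (1 - θ) * (∑ p, ‖ψ p‖ ^ 2) ≤
      ‖∑ p, star (ψ p) * ((∑ μ, wilsonHop ρ U μ) *ᵥ ψ) p‖) :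
    ∃ u : ℂ, ‖u‖ = 1 ∧
      ∀ μ, ∑ p, ‖(wilsonHop ρ U μ *ᵥ ψ) p - u * ψ p‖ ^ 2 ≤ 8 * θ * ∑ p, ‖ψ p‖ ^ 2 := by
  -- the `W_μ` are isometries (adapted from
  -- `Literature.Computability.QuantumComplexity.PolynomialMethod.sum_norm_sq_mulVec_of_mem_unitaryGroup`)
  have hre : ∀ w : TorusSite 4 L × Fin N × Fin 4 → ℂ, ∑ i, ‖w i‖ ^ 2 = (star w ⬝ᵥ w).re := by
    intro w
    simp only [dotProduct, Pi.star_apply, Complex.re_sum]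
    refine Finset.sum_congr rfl fun i _ => ?_
    rw [Complex.star_def, Complex.conj_mul']
    norm_cast
  have hiso' : ∀ μ, ∑ p, ‖(wilsonHop ρ U μ *ᵥ ψ) p‖ ^ 2 = ∑ p, ‖ψ p‖ ^ 2 := fun μ => by
    rw [hre, hre, star_mulVec, dotProduct_mulVec, vecMul_vecMul, conjTranspose_mul_wilsonHop ρ hρ U μ,
      vecMul_one]
  let ψ' : EuclideanSpace ℂ (TorusSite 4 L × Fin N × Fin 4) := WithLp.toLp 2 ψ
  let φ : Fin 4 → EuclideanSpace ℂ (TorusSite 4 L × Fin N × Fin 4) := fun μ =>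
    WithLp.toLp 2 (wilsonHop ρ U μ *ᵥ ψ)
  have hnorm : ‖ψ'‖ ^ 2 = ∑ p, ‖ψ p‖ ^ 2 := EuclideanSpace.norm_sq_eq ψ'
  have hiso : ∀ μ ∈ (Finset.univ : Finset (Fin 4)), ‖φ μ‖ = ‖ψ'‖ := fun μ _ => by
    have h1 : ‖φ μ‖ ^ 2 = ‖ψ'‖ ^ 2 := by
      rw [hnorm, EuclideanSpace.norm_sq_eq]
      exact hiso' μ
    exact (sq_eq_sq₀ (norm_nonneg _) (norm_nonneg _)).mp h1
  have hinner : ∑ μ ∈ (Finset.univ : Finset (Fin 4)), ⟪ψ', φ μ⟫_ℂ =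
      ∑ p, star (ψ p) * ((∑ μ, wilsonHop ρ U μ) *ᵥ ψ) p := by
    simp only [ψ', φ, EuclideanSpace.inner_toLp_toLp, dotProduct, Pi.star_apply]
    rw [Finset.sum_comm, Matrix.sum_mulVec]
    refine Finset.sum_congr rfl fun p _ => ?_
    rw [Finset.sum_apply, Finset.mul_sum]
    exact Finset.sum_congr rfl fun μ _ => mul_comm _ _
  have hsum : ((Finset.univ : Finset (Fin 4)).card : ℝ) * (1 - θ) * ‖ψ'‖ ^ 2 ≤
      ‖∑ μ ∈ (Finset.univ : Finset (Fin 4)), ⟪ψ', φ μ⟫_ℂ‖ := by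
    rw [Finset.card_univ, Fintype.card_fin, hinner, hnorm]
    exact_mod_cast hflat
  obtain ⟨u, hu, h⟩ := norm_sub_phase_smul_sq_le_of_sum_inner Finset.univ φ ψ' θ hiso hsum
  refine ⟨u, hu, fun μ => ?_⟩
  have hμ := h μ (Finset.mem_univ μ)
  rw [Finset.card_univ, Fintype.card_fin, hnorm, EuclideanSpace.norm_sq_eq] at hμ
  calc ∑ p, ‖(wilsonHop ρ U μ *ᵥ ψ) p - u * ψ p‖ ^ 2 = ∑ p, ‖(φ μ - u • ψ') p‖ ^ 2 := rfl
    _ ≤ 2 * ((4 : ℕ) : ℝ) * θ * ∑ p, ‖ψ p‖ ^ 2 := hμ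
    _ = 8 * θ * ∑ p, ‖ψ p‖ ^ 2 := by norm_num

end Lattice

end Summit.QuantumFields.QCD.Cruxes.WindowExtinction.CornerDecorrelationDeepHole

end
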